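import Summits.Ventures.PercRepro.GenQClassElevenSixteen

/-!
# PercRepro — the last class of corank `11`, part B: the disjoint complements and `h₁₆ = 0` (night-4, gen 14)

Part A (`GenQClassElevenSixteen`) shows that two distinct `15`-traces of an `18`-point set with `h₁₅ = 5`, `h₁₄ = 0` meet
`G` in neither `13` nor `14` points.  Here: they meet in exactly `12` (`card_inter_eq_twelve`), so every point of `G`
lies in one of any two of them (`mem_or_mem_of_ne` — the five complements are pairwise disjoint), and
**`hypTr_sixteen_eq_zero_of_five_zero`**: there is no `16`-trace.  A `16`-trace `K` misses a point `u` of `G`; at most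
one `15`-trace misses `u`, so three of them contain it; two of them meet in a rank-`5` flat `F` not inside the third
(which misses a point of `F ∩ G`), so `S = F ∩ H₃` is a flat of rank `≤ 4`; `S` has `≥ 18 − 9 = 9` points of `G` and
`u ∈ S ∖ K`, so `K ∩ S` is a flat of rank `≤ 3` with `≥ 9 − 2 = 7` points of `G` — impossible on the core
(`flats_le_three_card_le_six`).  With this lemma the class `(h₁₆ ≤ 1, h₁₅ = 5, h₁₄ = 0)` of the corank-`11` split is the
class `h₁₆ = 0 ∧ h₁₅ = 5 ∧ h₁₄ = 0`, which the two-level LP certifies on tree rows (`+73,482.61`, kit j269513).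
Imports `GenQClassElevenSixteen` only.
-/
namespace PercRepro.Night4

open Finset ThmH SixFour GenQ PerFlat Star

variable {α : Type*} [DecidableEq α] {M : Matroid α} [M.Finite]

/-- Distinct `15`-traces meet `G` in exactly `12` points when `h₁₅ = 5` and `h₁₄ = 0` (`n = 18`). -/
theorem card_inter_eq_twelve (hs : Simple M) (hline : ∀ L ∈ flatsQ M 2, L.card ≤ 3)
    (hplane : ∀ P ∈ flatsQ M 3, P.card ≤ 6) (hsolid : ∀ F ∈ flatsQ M 4, F.card ≤ 10) {G : Finset α}
    (hG : G ⊆ gr M) (hcard : G.card = 18) (h15 : hypTr M G 6 15 = 5) (h14 : hypTr M G 6 14 = 0)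
    {H₁ H₂ : Finset α} (hH₁ : H₁ ∈ flatsTr M G 6 15) (hH₂ : H₂ ∈ flatsTr M G 6 15) (hne : H₁ ≠ H₂) :
    ((H₁ ∩ H₂) ∩ G).card = 12 := by
  have h12 := two_mul_sub_le_card_inter_of_mem_flatsTr hH₁ hH₂
  have h14' := card_inter_le_fourteen hH₁ hH₂ hne
  have hn13 := card_inter_ne_thirteen hs hline hplane hsolid hG hcard h14 hH₁ hH₂ hne
  have hn14 := card_inter_ne_fourteen hs hline hplane hsolid hcard h15 hH₁ hH₂ hne
  omega

/-- Every point of `G` lies in one of two distinct `15`-traces (`h₁₅ = 5`, `h₁₄ = 0`, `n = 18`): the complements are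
disjoint. -/
theorem mem_or_mem_of_ne (hs : Simple M) (hline : ∀ L ∈ flatsQ M 2, L.card ≤ 3)
    (hplane : ∀ P ∈ flatsQ M 3, P.card ≤ 6) (hsolid : ∀ F ∈ flatsQ M 4, F.card ≤ 10) {G : Finset α}
    (hG : G ⊆ gr M) (hcard : G.card = 18) (h15 : hypTr M G 6 15 = 5) (h14 : hypTr M G 6 14 = 0)
    {H₁ H₂ : Finset α} (hH₁ : H₁ ∈ flatsTr M G 6 15) (hH₂ : H₂ ∈ flatsTr M G 6 15) (hne : H₁ ≠ H₂)
    {x : α} (hx : x ∈ G) : x ∈ H₁ ∨ x ∈ H₂ := by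
  have h12 := card_inter_eq_twelve hs hline hplane hsolid hG hcard h15 h14 hH₁ hH₂ hne
  have h1 := mem_flatsTr.1 hH₁
  have h2 := mem_flatsTr.1 hH₂
  have hU : (H₁ ∩ G) ∪ (H₂ ∩ G) ⊆ G := by
    intro z hz
    rw [Finset.mem_union, Finset.mem_inter, Finset.mem_inter] at hz
    rcases hz with hz | hz
    · exact hz.2
    · exact hz.2
  have hUcard : ((H₁ ∩ G) ∪ (H₂ ∩ G)).card = 18 := by
    have := Finset.card_union_add_card_inter (H₁ ∩ G) (H₂ ∩ G)
    rw [← inter_inter_eq, h12, h1.2.1, h2.2.1] at this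
    omega
  have heq : (H₁ ∩ G) ∪ (H₂ ∩ G) = G := Finset.eq_of_subset_of_card_le hU (by omega)
  have hx' : x ∈ (H₁ ∩ G) ∪ (H₂ ∩ G) := by rw [heq]; exact hx
  rw [Finset.mem_union, Finset.mem_inter, Finset.mem_inter] at hx'
  rcases hx' with hx' | hx'
  · exact Or.inl hx'.1
  · exact Or.inr hx'.1

/-- **No `16`-trace in the class `h₁₅ = 5`, `h₁₄ = 0`** (`n = 18`, `q = 7`, the core): a `16`-trace `K` misses two
points of `G`; three of the five `15`-traces contain one of them, `u`; their intersection `S` is a flat of rank `≤ 4`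
with `≥ 9` points of `G` not inside `K`, so `K ∩ S` is a flat of rank `≤ 3` with `≥ 7` points. -/
theorem hypTr_sixteen_eq_zero_of_five_zero (hs : Simple M) (hline : ∀ L ∈ flatsQ M 2, L.card ≤ 3)
    (hplane : ∀ P ∈ flatsQ M 3, P.card ≤ 6) (hsolid : ∀ F ∈ flatsQ M 4, F.card ≤ 10) {G : Finset α}
    (hG : G ⊆ gr M) (hcard : G.card = 18) (h15 : hypTr M G 6 15 = 5) (h14 : hypTr M G 6 14 = 0) :
    hypTr M G 6 16 = 0 := by
  have hB := flats_le_four_card_le_ten hs hline hplane hsolid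
  have hB3 := flats_le_three_card_le_six hs hline hplane
  unfold hypTr
  rw [Finset.card_eq_zero, Finset.eq_empty_iff_forall_notMem]
  intro K hK
  have hK' := mem_flatsTr.1 hK
  have hKflat := (mem_flatsQ.1 hK'.1).2.1
  -- the two points of `G` outside `K`
  have hGK : (G \ K).card = 2 := by
    rw [Finset.card_sdiff, hcard, hK'.2.1]
  obtain ⟨u, hu⟩ : (G \ K).Nonempty := by
    rw [← Finset.card_pos, hGK]; norm_num
  rw [Finset.mem_sdiff] at hu
  -- the `15`-traces through `u`: at most one misses `u`
  set Tu := (flatsTr M G 6 15).filter (fun H => u ∈ H) with hTudef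
  have hTu : 3 ≤ Tu.card := by
    have hsplit := Finset.card_filter_add_card_filter_not (s := flatsTr M G 6 15) (fun H => u ∈ H)
    have hone : ((flatsTr M G 6 15).filter (fun H => ¬ u ∈ H)).card ≤ 1 := by
      rw [Finset.card_le_one]
      intro H hH H' hH'
      rw [Finset.mem_filter] at hH hH'
      by_contra hne
      rcases mem_or_mem_of_ne hs hline hplane hsolid hG hcard h15 h14 hH.1 hH'.1 hne hu.1 with h | h
      · exact hH.2 h
      · exact hH'.2 h
    unfold hypTr at h15
    rw [h15] at hsplit
    rw [hTudef]
    omega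
  obtain ⟨H₁, H₂, H₃, hH₁, hH₂, hH₃, h12, h13, h23⟩ := Finset.two_lt_card_iff.1 (by omega : 2 < Tu.card)
  rw [hTudef, Finset.mem_filter] at hH₁ hH₂ hH₃
  -- `F = H₁ ∩ H₂` is a rank-`5` flat not inside `H₃`
  have hF : H₁ ∩ H₂ ∈ flatsQ M 5 :=
    inter_mem_flatsQ_of_large_traces (q := 7) (s := 15) (B := 10) (by norm_num) hB hH₁.1 hH₂.1 h12 (by omega)
  have hH₃' := mem_flatsTr.1 hH₃.1
  have hnot : ¬ H₁ ∩ H₂ ⊆ H₃ := by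
    intro hsub
    have hGH₃ : (G \ H₃).card = 3 := by rw [Finset.card_sdiff, hcard, hH₃'.2.1]
    obtain ⟨c, hc⟩ : (G \ H₃).Nonempty := by rw [← Finset.card_pos, hGH₃]; norm_num
    rw [Finset.mem_sdiff] at hc
    have hc1 : c ∈ H₁ := by
      rcases mem_or_mem_of_ne hs hline hplane hsolid hG hcard h15 h14 hH₁.1 hH₃.1 h13 hc.1 with h | h
      · exact h
      · exact absurd h hc.2
    have hc2 : c ∈ H₂ := by
      rcases mem_or_mem_of_ne hs hline hplane hsolid hG hcard h15 h14 hH₂.1 hH₃.1 h23 hc.1 with h | h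
      · exact h
      · exact absurd h hc.2
    exact hc.2 (hsub (Finset.mem_inter.2 ⟨hc1, hc2⟩))
  obtain ⟨b, hS, hb⟩ := exists_inter_mem_flatsQ_lt_of_not_subset hF (mem_flatsQ.1 hH₃'.1).2.1 hnot
  -- `S = (H₁ ∩ H₂) ∩ H₃` has `≥ 9` points of `G`
  have hScard : 9 ≤ (((H₁ ∩ H₂) ∩ H₃) ∩ G).card := by
    have hcover : G \ ((H₁ ∩ H₂) ∩ H₃) ⊆ (G \ H₁) ∪ ((G \ H₂) ∪ (G \ H₃)) := by
      intro x hx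
      rw [Finset.mem_sdiff, Finset.mem_inter, Finset.mem_inter] at hx
      rw [Finset.mem_union, Finset.mem_union, Finset.mem_sdiff, Finset.mem_sdiff, Finset.mem_sdiff]
      by_cases h1 : x ∈ H₁
      · by_cases h2 : x ∈ H₂
        · exact Or.inr (Or.inr ⟨hx.1, fun h3 => hx.2 ⟨⟨h1, h2⟩, h3⟩⟩)
        · exact Or.inr (Or.inl ⟨hx.1, h2⟩)
      · exact Or.inl ⟨hx.1, h1⟩
    have hc1 : (G \ H₁).card = 3 := by rw [Finset.card_sdiff, hcard, (mem_flatsTr.1 hH₁.1).2.1]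
    have hc2 : (G \ H₂).card = 3 := by rw [Finset.card_sdiff, hcard, (mem_flatsTr.1 hH₂.1).2.1]
    have hc3 : (G \ H₃).card = 3 := by rw [Finset.card_sdiff, hcard, hH₃'.2.1]
    have hle := (Finset.card_le_card hcover).trans
      ((Finset.card_union_le _ _).trans (Nat.add_le_add_left (Finset.card_union_le _ _) _))
    have hsd := Finset.card_sdiff (s := (H₁ ∩ H₂) ∩ H₃) (t := G)
    omega
  -- `u ∈ S`, `u ∉ K`: `S ⊄ K`, so `K ∩ S` has rank `≤ 3` and `≤ 6` points, but `≥ 7` points of `G`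
  have huS : u ∈ (H₁ ∩ H₂) ∩ H₃ := Finset.mem_inter.2 ⟨Finset.mem_inter.2 ⟨hH₁.2, hH₂.2⟩, hH₃.2⟩
  have hnotK : ¬ (H₁ ∩ H₂) ∩ H₃ ⊆ K := fun h => hu.2 (h huS)
  obtain ⟨b', hSK, hb'⟩ := exists_inter_mem_flatsQ_lt_of_not_subset hS hKflat hnotK
  have hsix : (((H₁ ∩ H₂) ∩ H₃) ∩ K).card ≤ 6 := hB3 b' (by omega) _ hSK
  have hseven : 7 ≤ ((((H₁ ∩ H₂) ∩ H₃) ∩ K) ∩ G).card := by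
    have hcover : ((H₁ ∩ H₂) ∩ H₃) ∩ G ⊆ ((((H₁ ∩ H₂) ∩ H₃) ∩ K) ∩ G) ∪ (G \ K) := by
      intro x hx
      rw [Finset.mem_inter] at hx
      rw [Finset.mem_union, Finset.mem_inter, Finset.mem_inter, Finset.mem_sdiff]
      by_cases hxK : x ∈ K
      · exact Or.inl ⟨⟨hx.1, hxK⟩, hx.2⟩
      · exact Or.inr ⟨hx.2, hxK⟩
    have := (Finset.card_le_card hcover).trans (Finset.card_union_le _ _)
    omega
  have := Finset.card_le_card (Finset.inter_subset_left : (((H₁ ∩ H₂) ∩ H₃) ∩ K) ∩ G ⊆ ((H₁ ∩ H₂) ∩ H₃) ∩ K)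
  omega

end PercRepro.Night4
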